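import Literature.AlgebraicGeometry.Resolution.HironakaDirectrixPrincipal
import Literature.AlgebraicGeometry.Resolution.RidgeEqualDegree
import HarnessLib

/-!
# `𝒯(⟨G⟩) = T(G)`: the CJS directrix space of a cone defined by forms of one degree is Hironaka's directrix of the
# set of defining forms — every characteristic (CJS 2020 Lemma 2.7 / Def. 2.8; Cossart–Piltant 2008, proof of Prop. 4.2)

Topic: `Literature/AlgebraicGeometry/Resolution`. Sequel of `HironakaDirectrixIdeal.lean` (`𝒯(I) ⊆ T(S)` for every
generating set `S` of `I`, with equality for SOME `S`) and `HironakaDirectrixPrincipal.lean` (equality for the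
principal ideal of a nonzero form). The tangent cone of an ideal exponent `(J, b)` at a point of order `b` is cut out by
the set `G = cl_b(J)` of initial forms of ONE degree `b`; for such sets the inequality is an equality in EVERY
characteristic:

> **CJS 2020, Lemma 2.7.** `𝒯(I)` is the smallest subspace `T ⊆ S_1` with `I = (I ∩ k[T]) S`. **Cossart–Piltant 2008,
> proof of Prop. 4.2.** `T(S)` is the smallest `T'` with `S ⊆ k[T']` (`HironakaDirectrixSpan.directrix_eq_sInf`).

PROVED here:
* `subset_linearFormsSubalgebra_of_span_eq` — if `(S) = ⟨G⟩` with `S ⊆ k[T']` and `G` forms of one degree `b`, then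
  `G ⊆ k[T']` (degree-`b` components: `g = Σ_s a_s s` gives `g = Σ_s a_s(0) · s_b` because the ideal `⟨G⟩` has nothing
  below degree `b`, and `s_b ∈ k[T']` since `k[T']` is graded) — the principal case is
  `mem_linearFormsSubalgebra_of_span_singleton_eq`;
* **`directrixSpace_span_eq_map_directrix_of_forall_isHomogeneous`** — `𝒯(⟨G⟩) = T(G)` (through the encoding
  `linearFormPolyₗ` of functionals as linear forms), hence **`finrank_directrixSpace_span_eq_hironakaTau_of_forall`**:
  `dim_k 𝒯(⟨G⟩) = τ(G)` and `directrixDim_span_eq` : `e(S/⟨G⟩) = n − τ(G)`.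

(For TAME `b` a different proof, through the ridge, is `RidgeDirectrixTame.directrixSpace_span_eq_map_directrix`.)
Written for the cell res-hironaka (seat res-L1-s46-pv-7, W4.6). AI-written; AI review is weaker than expert review.

## References

* V. Cossart, U. Jannsen, S. Saito, LNM 2270 (2020), Lemma 2.7, Def. 2.8. [CossartJannsenSaito2020]
* V. Cossart, O. Piltant, J. Algebra 320 (2008), proof of Prop. 4.2. [CossartPiltant2008]
-/

noncomputable section

open MvPolynomial Module
open Literature.RingTheory.MvPolynomial

namespace Literature.AlgebraicGeometry.Resolution

universe u

variable {k : Type u} [Field k] {d : ℕ}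

/-- Elements of an ideal generated by forms of degree `b` have no homogeneous components below degree `b`. [folklore] -/
private theorem homogeneousComponent_eq_zero_of_mem_span {G : Set (MvPolynomial (Fin d) k)} {b : ℕ}
    (hG : ∀ g ∈ G, g.IsHomogeneous b) {s : MvPolynomial (Fin d) k} (hs : s ∈ Ideal.span G) {j : ℕ} (hj : j < b) :
    homogeneousComponent j s = 0 := by
  classical
  ext m
  rw [coeff_homogeneousComponent, coeff_zero]
  split_ifs with hm
  · have hs' : MvPolynomial.map (algebraMap k k) s ∈ coneIdeal k (Ideal.span G) := by
      rw [coneIdeal]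
      exact Ideal.mem_map_of_mem _ hs
    have h := coeff_eq_zero_of_mem_coneIdeal_span hG hs' (m := m) (by omega)
    rwa [coeff_map, Algebra.algebraMap_self, RingHom.id_apply] at h
  · rfl

/-- `α ≤ β`, `α ≠ β` forces `|α| < |β|`. [folklore] -/
private theorem degree_lt_of_le_of_ne {α β : Fin d →₀ ℕ} (h : α ≤ β) (hne : α ≠ β) : α.degree < β.degree := by
  have hβ : α + (β - α) = β := add_tsub_cancel_of_le h
  have hd := congrArg Finsupp.degree hβ
  rw [map_add] at hd
  have hpos : (β - α).degree ≠ 0 := by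
    intro h0
    rw [Finsupp.degree_eq_zero_iff] at h0
    exact hne (by rw [← hβ, h0, add_zero])
  omega

/-- Coefficients below degree `b` vanish when all homogeneous components below degree `b` vanish. [folklore] -/
private theorem coeff_eq_zero_of_forall_lt {s : MvPolynomial (Fin d) k} {b : ℕ}
    (hs : ∀ j < b, homogeneousComponent j s = 0) {y : Fin d →₀ ℕ} (hy : y.degree < b) : coeff y s = 0 := by
  classical
  have h := coeff_homogeneousComponent y.degree s y
  rw [if_pos rfl, hs _ hy, coeff_zero] at h
  exact h.symm

/-- The degree-`b` component of `a · s` for `s` without components below degree `b`: `(a s)_b = a(0) · s_b`. [folklore] -/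
private theorem homogeneousComponent_mul_eq_of_forall_lt {a s : MvPolynomial (Fin d) k} {b : ℕ}
    (hs : ∀ j < b, homogeneousComponent j s = 0) :
    homogeneousComponent b (a * s) = C (coeff 0 a) * homogeneousComponent b s := by
  classical
  ext m
  rw [coeff_homogeneousComponent, coeff_C_mul, coeff_homogeneousComponent]
  split_ifs with hm
  · rw [coeff_mul, Finset.sum_eq_single (0, m)]
    · rintro ⟨x, y⟩ hxy hne
      rw [Finset.HasAntidiagonal.mem_antidiagonal] at hxy
      simp only at hxy
      have hyle : y ≤ m := by rw [← hxy]; exact le_add_self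
      have hym : y ≠ m := by
        rintro rfl
        have hx : x = 0 := by
          have h2 : x + y = 0 + y := by rw [hxy, zero_add]
          exact add_right_cancel h2
        exact hne (by rw [hx])
      rw [coeff_eq_zero_of_forall_lt hs ((degree_lt_of_le_of_ne hyle hym).trans_le hm.le), mul_zero]
    · intro h
      exact absurd (Finset.HasAntidiagonal.mem_antidiagonal.mpr (zero_add m)) h
  · rw [mul_zero]

/-- **If `(S) = ⟨G⟩` with `S ⊆ k[T']` and `G` a set of forms of one degree, then `G ⊆ k[T']`** (degree-`b` components;
generalises the principal case `mem_linearFormsSubalgebra_of_span_singleton_eq`). [cite: CossartJannsenSaito2020, Lemma 2.7] -/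
theorem subset_linearFormsSubalgebra_of_span_eq {G : Set (MvPolynomial (Fin d) k)} {b : ℕ}
    (hG : ∀ g ∈ G, g.IsHomogeneous b) {T' : Submodule k (Module.Dual k (Fin d → k))} {S : Set (MvPolynomial (Fin d) k)}
    (hSU : S ⊆ linearFormsSubalgebra k T') (hSI : Ideal.span S = Ideal.span G) :
    G ⊆ linearFormsSubalgebra k T' := by
  classical
  intro g hg
  set U := linearFormsSubalgebra k T' with hU
  have hgr : IsGradedSubalgebra U := by
    rw [hU, linearFormsSubalgebra]
    refine IsGradedSubalgebra.adjoin ?_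
    rintro _ ⟨ℓ, _, rfl⟩
    exact ⟨1, isHomogeneous_linearFormPoly ℓ⟩
  -- `g = Σ_s c_s • s` with `s ∈ S`
  have hmem : g ∈ Ideal.span S := by rw [hSI]; exact Ideal.subset_span hg
  obtain ⟨c, hcS, hsum⟩ := (Submodule.mem_span_set (R := MvPolynomial (Fin d) k)).mp hmem
  -- degree-`b` components
  have hcomp : g = ∑ s ∈ c.support, C (coeff 0 (c s)) * homogeneousComponent b s := by
    conv_lhs => rw [← (homogeneousComponent_of_mem ((mem_homogeneousSubmodule _ _).mpr (hG g hg))).trans (if_pos rfl),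
      ← hsum]
    rw [Finsupp.sum, map_sum]
    refine Finset.sum_congr rfl fun s hs => ?_
    rw [smul_eq_mul]
    refine homogeneousComponent_mul_eq_of_forall_lt fun j hj => ?_
    have hsI : (s : MvPolynomial (Fin d) k) ∈ Ideal.span G := by rw [← hSI]; exact Ideal.subset_span (hcS hs)
    exact homogeneousComponent_eq_zero_of_mem_span hG hsI hj
  rw [hcomp]
  refine Subalgebra.sum_mem _ fun s hs => Subalgebra.mul_mem _ (Subalgebra.algebraMap_mem _ _) ?_
  exact hgr _ (hSU (hcS hs)) b

/-- **`𝒯(⟨G⟩) = T(G)` for a set `G` of forms of ONE degree, every characteristic.** [cite: CossartJannsenSaito2020, Lemma 2.7]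
[cite: CossartPiltant2008, proof of Prop. 4.2] -/
theorem directrixSpace_span_eq_map_directrix_of_forall_isHomogeneous {G : Set (MvPolynomial (Fin d) k)} {b : ℕ}
    (hG : ∀ g ∈ G, g.IsHomogeneous b) :
    directrixSpace (Ideal.span G) = (directrix k G).map (linearFormPolyₗ k) := by
  refine le_antisymm (directrixSpace_le_map_directrix rfl) ?_
  set I : Ideal (MvPolynomial (Fin d) k) := Ideal.span G with hI
  set T' := (directrixSpace I).comap (linearFormPolyₗ k) with hT'
  have hmap : T'.map (linearFormPolyₗ k) = directrixSpace I := map_comap_linearFormPolyₗ k (directrixSpace_le_one I)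
  have hdir : Directs I (T'.map (linearFormPolyₗ k)) := by
    rw [hmap]
    exact directs_directrixSpace I
  obtain ⟨S, hSU, hSI⟩ := directs_map_iff.mp hdir
  have hGU : G ⊆ linearFormsSubalgebra k T' := subset_linearFormsSubalgebra_of_span_eq hG hSU hSI
  have hle : directrix k G ≤ T' := directrix_le_of_subset k hGU
  calc (directrix k G).map (linearFormPolyₗ k) ≤ T'.map (linearFormPolyₗ k) := Submodule.map_mono hle
    _ = directrixSpace I := hmap

/-- **`dim_k 𝒯(⟨G⟩) = τ(G)`** for a set of forms of one degree. [cite: CossartJannsenSaito2020, Def. 2.8] -/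
theorem finrank_directrixSpace_span_eq_hironakaTau_of_forall {G : Set (MvPolynomial (Fin d) k)} {b : ℕ}
    (hG : ∀ g ∈ G, g.IsHomogeneous b) :
    Module.finrank k (directrixSpace (Ideal.span G)) = hironakaTau k G := by
  rw [directrixSpace_span_eq_map_directrix_of_forall_isHomogeneous hG, finrank_map_directrix]

/-- **`e(S/⟨G⟩) = d − τ(G)`**: the CJS directrix dimension of a cone defined in one degree is the codimension of
Hironaka's directrix of the defining forms. [cite: CossartJannsenSaito2020, Def. 2.8] -/
theorem directrixDim_span_eq_sub_hironakaTau {G : Set (MvPolynomial (Fin d) k)} {b : ℕ}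
    (hG : ∀ g ∈ G, g.IsHomogeneous b) : directrixDim (Ideal.span G) = d - hironakaTau k G := by
  rw [directrixDim, finrank_directrixSpace_span_eq_hironakaTau_of_forall hG]

/-- For a SUBSPACE of forms of degree `μ` (e.g. the initial forms `cl_μ(J)` of an ideal of a local ring): `𝒯(⟨W⟩) = T(W)`.
[cite: CossartPiltant2008, proof of Prop. 4.2] -/
theorem directrixSpace_span_submodule_eq_map_directrix {μ : ℕ} (W : Submodule k (MvPolynomial (Fin d) k))
    (hW : ∀ g ∈ W, g.IsHomogeneous μ) :
    directrixSpace (Ideal.span (W : Set (MvPolynomial (Fin d) k))) =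
      (directrix k (W : Set (MvPolynomial (Fin d) k))).map (linearFormPolyₗ k) :=
  directrixSpace_span_eq_map_directrix_of_forall_isHomogeneous fun g hg => hW g hg

end Literature.AlgebraicGeometry.Resolution

end
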